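import Mathlib
import Literature.Geometry.Symplectic.JHolomorphicSheetChartInverse
import Literature.Geometry.Symplectic.JHolomorphicSheetDbarLocal
import HarnessLib

/-!
# A leaf function read in the sheet chart of an immersed `J`-holomorphic sheet

Two reductions used in the proof of positivity of intersections of `J`-holomorphic curves in
dimension four, local index form (`Literature.Geometry.Symplectic.positivityOfIntersections_leafCoordinate`;
McDuff–Salamon (2012) §2.4 / App. E, McDuff (1991) Lemma 2.5 and Thm 1.1, Wendl (2020) App. B),
for a `4`-dimensional real normed space `F` with a smooth operator field `J`, an immersed
`J`-holomorphic sheet `b` through `b 0` and a second `J`-holomorphic sheet `v` with `v 0 = b 0`: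

* `sheet_reduction` — the content of `Literature.Geometry.Symplectic.sheet_dichotomy`
  (`JHolomorphicSheetDichotomy.lean`) with its intermediate data KEPT: a sheet chart
  `e = sheetChart J b ν₀` (`JHolomorphicSheetChart*.lean`) with injective differential at `(0,0)`,
  a radius `ρ₁` on which `v` stays in its target and `e.symm ∘ v` is smooth, and for the normal
  coordinate `c = (e.symm ∘ v).2` radii/constants with `c` smooth on `B(0, 2ρ)`, `2ρ < ρ₁`, and
  `‖∂̄ c‖ ≤ M ‖c‖` on `B̄(0, ρ)` (`sheetDbarInequality_local`);
* `leafFunction_sheetChart` — a LEAF FUNCTION `ψ` (smooth near `b 0`, vanishing along `b`, with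
  `dψ_{b 0}` surjective and complex-linear for `J (b 0)`) read in the sheet chart:
  `α₀ := dψ_{b 0} ν₀ ≠ 0` (dimension count `ker dψ = im db(0)` and injectivity of `de_{(0,0)}`),
  `d(ψ ∘ e)_{(0,0)} (σ, β) = β α₀`, and near `(0,0)` the chart maps into the domain of `ψ`,
  `ψ ∘ e` is smooth, vanishes on the axis `{β = 0}` and satisfies
  `‖ψ (e (σ, β)) - β α₀‖ ≤ (‖α₀‖/2) ‖β‖` (mean value inequality) — so that zeros and winding
  numbers of `ψ ∘ v` are those of the normal coordinate `c`.

Everything is proved; no named facts.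

## References

* D. McDuff, D. Salamon, *J-holomorphic curves and symplectic topology*, 2nd ed. (2012), §2.4,
  App. E. [McDuffSalamon2012]
* D. McDuff, *The local behaviour of holomorphic curves in almost complex 4-manifolds*,
  J. Differential Geom. 34 (1991), Lemma 2.5, Thm 1.1. [McDuff1991LocalBehaviour]
-/

noncomputable section

open scoped ContDiff Topology
open Filter Set Metric Function
open Literature.Analysis.Complex

namespace Literature.Geometry.Symplectic

namespace LeafCoordinate


variable {F : Type*} [NormedAddCommGroup F] [NormedSpace ℝ F]

/-- **The sheet reduction, with the `∂̄`-inequality kept.** As `sheet_dichotomy` (two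
`J`-holomorphic sheets through `v 0 = b 0`, `b` immersed at `0`, `dim F = 4`), but recording the
intermediate data: a sheet chart `e = sheetChart J b ν₀` with injective differential at `(0,0)`,
a radius `ρ₁` on which `v` stays in its target, and for the normal coordinate
`c ζ = (e.symm (v ζ)).2` a radius `ρ` and a constant `M` with `c` smooth on `B(0, 2ρ)`,
`2ρ < ρ₁`, and `‖∂̄ c‖ ≤ M ‖c‖` on `B̄(0, ρ)`. [cite: McDuffSalamon2012, §2.4 and App. E (reduction to the similarity principle)] -/
theorem sheet_reduction [FiniteDimensional ℝ F] (h4 : Module.finrank ℝ F = 4)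
    {J : F → F →L[ℝ] F} (hJ : ContDiff ℝ ∞ J)
    {b v : ℂ → F} {R₁ R₂ : ℝ} (hR₁ : 0 < R₁) (hR₂ : 0 < R₂)
    (hb : ContDiff ℝ ∞ b)
    (hbJ : ∀ z ∈ ball 0 R₁, ∀ α : ℂ, fderiv ℝ b z (Complex.I * α) = J (b z) (fderiv ℝ b z α))
    (hJ2 : ∀ z ∈ ball 0 R₁, ∀ w : F, J (b z) (J (b z) w) = -w)
    (hinj : Injective (fderiv ℝ b 0))
    (hv : ContDiff ℝ ∞ v)
    (hvJ : ∀ z ∈ ball 0 R₂, ∀ α : ℂ, fderiv ℝ v z (Complex.I * α) = J (v z) (fderiv ℝ v z α))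
    (hx : v 0 = b 0) :
    ∃ (ν₀ : F) (e : OpenPartialHomeomorph (ℂ × ℂ) F) (ρ₁ ρ M : ℝ),
      ⇑e = sheetChart J b ν₀ ∧ ((0, 0) : ℂ × ℂ) ∈ e.source ∧ ContDiffOn ℝ ∞ e.symm e.target ∧
      Injective (sheetChartDeriv J b ν₀ 0) ∧
      0 < ρ₁ ∧ (∀ ζ ∈ ball 0 ρ₁, v ζ ∈ e.target) ∧ e.symm (v 0) = (0, 0) ∧
      ContDiffOn ℝ ∞ (fun ζ => e.symm (v ζ)) (ball 0 ρ₁) ∧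
      0 < ρ ∧ 2 * ρ < ρ₁ ∧
      ContDiffOn ℝ ∞ (fun ζ => (e.symm (v ζ)).2) (ball 0 (2 * ρ)) ∧
      ∀ ζ ∈ closedBall (0 : ℂ) ρ, ‖dbarAlong 1 (fun ζ => (e.symm (v ζ)).2) ζ‖ ≤
        M * ‖(e.symm (v ζ)).2‖ := by
  -- the sheet chart and its local inverse
  obtain ⟨ν₀, e, hcoe, hsrc, hsymm, r, B, hr, hball, hB⟩ :=
    exists_sheetChart_localInverse h4 hJ hb hinj (hbJ 0 (mem_ball_self hR₁))
      (hJ2 0 (mem_ball_self hR₁))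
  have hE : ContDiff ℝ ∞ (sheetChart J b ν₀) := contDiff_sheetChart hJ hb ν₀
  have hdE : ∀ ζ : ℂ, fderiv ℝ (sheetChart J b ν₀) (ζ, 0) = sheetChartDeriv J b ν₀ ζ := fun ζ =>
    (hasFDerivAt_sheetChart ((hb.differentiable (by simp)) ζ)
      (((hJ.clm_apply contDiff_const).differentiable (by simp)) _)).fderiv
  -- injectivity of the differential at `(0, 0)` from the lower bound
  have hinjE : Injective (sheetChartDeriv J b ν₀ 0) := by
    rw [← hdE 0]
    refine (injective_iff_map_eq_zero _).2 fun q hq => ?_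
    have h := hB (0, 0) (mem_ball_self hr) q
    rw [hq, norm_zero, mul_zero] at h
    exact norm_le_zero_iff.1 h
  -- a radius `r'` on which the axis is `J`-holomorphic
  set r' : ℝ := min r R₁ with hr'_def
  have hr' : 0 < r' := lt_min hr hR₁
  have hr'r : r' ≤ r := min_le_left _ _
  have hhol : ∀ ζ : ℂ, ‖ζ - 0‖ < r' → ∀ α β : ℂ,
      J ((sheetChart J b ν₀) (ζ, 0)) (fderiv ℝ (sheetChart J b ν₀) (ζ, 0) (α, β)) =
        fderiv ℝ (sheetChart J b ν₀) (ζ, 0) (Complex.I * α, Complex.I * β) := by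
    intro ζ hζ α β
    have hζ₁ : ζ ∈ ball 0 R₁ := by
      rw [mem_ball, dist_eq_norm]
      exact hζ.trans_le (min_le_right _ _)
    rw [hdE ζ, sheetChart_mk_zero]
    exact sheetChartDeriv_hol (hbJ ζ hζ₁) (hJ2 ζ hζ₁) α β
  have hB' : ∀ p ∈ ball ((0, 0) : ℂ × ℂ) r', ∀ q : ℂ × ℂ,
      ‖q‖ ≤ B * ‖fderiv ℝ (sheetChart J b ν₀) p q‖ :=
    fun p hp q => hB p (ball_subset_ball hr'r hp) q
  -- a radius `ρ₁` about `0` on which `v` stays in the target and `e.symm ∘ v` in the small ball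
  have hxt : v 0 ∈ e.target := by
    rw [hx, ← sheetChart_mk_zero J b ν₀ 0, ← hcoe]
    exact e.map_source hsrc
  have hsx : e.symm (v 0) = (0, 0) := by
    rw [hx, ← sheetChart_mk_zero J b ν₀ 0, ← hcoe]
    exact e.left_inv hsrc
  have hcont : ContinuousAt (fun ζ => e.symm (v ζ)) 0 :=
    (e.continuousAt_symm hxt).comp hv.continuous.continuousAt
  have hev : ∀ᶠ ζ in 𝓝 (0 : ℂ), v ζ ∈ e.target ∧ e.symm (v ζ) ∈ ball ((0, 0) : ℂ × ℂ) r' := by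
    filter_upwards [hv.continuous.continuousAt.preimage_mem_nhds (e.open_target.mem_nhds hxt),
      hcont.preimage_mem_nhds (isOpen_ball.mem_nhds (by rw [hsx]; exact mem_ball_self hr'))]
      with ζ h1 h2
    exact ⟨h1, h2⟩
  obtain ⟨ρ₁', hρ₁', hρ₁'b⟩ := Metric.eventually_nhds_iff_ball.1 hev
  set ρ₁ : ℝ := min ρ₁' R₂ with hρ₁_def
  have hρ₁ : 0 < ρ₁ := lt_min hρ₁' hR₂
  have hρ₁b : ∀ ζ ∈ ball (0 : ℂ) ρ₁, v ζ ∈ e.target ∧ e.symm (v ζ) ∈ ball ((0, 0) : ℂ × ℂ) r' :=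
    fun ζ hζ => hρ₁'b ζ (ball_subset_ball (min_le_left _ _) hζ)
  -- the coordinates `(a, c) = e.symm ∘ v`
  set a : ℂ → ℂ := fun ζ => (e.symm (v ζ)).1 with ha_def
  set c : ℂ → ℂ := fun ζ => (e.symm (v ζ)).2 with hc_def
  have hac : ∀ ζ, (a ζ, c ζ) = e.symm (v ζ) := fun ζ => rfl
  have hsv : ContDiffOn ℝ ∞ (fun ζ => e.symm (v ζ)) (ball 0 ρ₁) :=
    hsymm.comp hv.contDiffOn fun ζ hζ => (hρ₁b ζ hζ).1
  have ha : ContDiffOn ℝ ∞ a (ball 0 ρ₁) := contDiff_fst.comp_contDiffOn hsv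
  have hc : ContDiffOn ℝ ∞ c (ball 0 ρ₁) := contDiff_snd.comp_contDiffOn hsv
  have hin : ∀ ζ ∈ ball (0 : ℂ) ρ₁, (a ζ, c ζ) ∈ ball ((0, 0) : ℂ × ℂ) r' :=
    fun ζ hζ => (hρ₁b ζ hζ).2
  -- `(sheetChart J b ν₀) ∘ (a, c) = v` on the ball, hence `J`-holomorphic there
  have hEv : ∀ ζ ∈ ball (0 : ℂ) ρ₁, (sheetChart J b ν₀) (a ζ, c ζ) = v ζ := fun ζ hζ => by
    rw [hac, ← hcoe]
    exact e.right_inv (hρ₁b ζ hζ).1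
  have hJhol : ∀ ζ ∈ ball (0 : ℂ) ρ₁, ∀ θ : ℂ,
      fderiv ℝ (fun ζ => (sheetChart J b ν₀) (a ζ, c ζ)) ζ (Complex.I * θ) =
        J ((sheetChart J b ν₀) (a ζ, c ζ))
          (fderiv ℝ (fun ζ => (sheetChart J b ν₀) (a ζ, c ζ)) ζ θ) := by
    intro ζ hζ θ
    have heq : (fun ζ => (sheetChart J b ν₀) (a ζ, c ζ)) =ᶠ[𝓝 ζ] v := by
      filter_upwards [isOpen_ball.mem_nhds hζ] with ζ' hζ'
      exact hEv ζ' hζ'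
    rw [heq.fderiv_eq, hEv ζ hζ]
    exact hvJ ζ (ball_subset_ball (min_le_right _ _) hζ) θ
  -- the scalar reduction: `‖∂̄ c‖ ≤ M ‖c‖` on a closed disc about `0`
  obtain ⟨ρ, M, hρ, hρρ₁, -, hbound⟩ := sheetDbarInequality_local J hJ (sheetChart J b ν₀) hE 0 r'
    B hr' hhol hB' a c 0 ρ₁ hρ₁ ha hc hin hJhol
  have hc' : ContDiffOn ℝ ∞ c (ball 0 (2 * (ρ / 2))) := by
    rw [mul_div_cancel₀ ρ two_ne_zero]
    exact hc.mono (ball_subset_ball hρρ₁.le)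
  have hbound' : ∀ ζ ∈ closedBall (0 : ℂ) (ρ / 2), ‖dbarAlong 1 c ζ‖ ≤ M * ‖c ζ‖ :=
    fun ζ hζ => hbound ζ (closedBall_subset_closedBall (by linarith) hζ)
  exact ⟨ν₀, e, ρ₁, ρ / 2, M, hcoe, hsrc, hsymm, hinjE, hρ₁, fun ζ hζ => (hρ₁b ζ hζ).1, hsx, hsv,
    by linarith, by linarith, hc', hbound'⟩


/-- **The leaf function in the sheet chart.** Let `E = sheetChart J b ν₀` have injective
differential at `(0, 0)` (`dim F = 4`, `b` immersed at `0`), and let `ψ` be smooth on an open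
`T ∋ b 0`, vanish along `b` near `0`, with `dψ_{b 0}` surjective and complex-linear for `J (b 0)`.
Then `α₀ := dψ_{b 0} ν₀ ≠ 0`, `d(ψ ∘ E)_{(0,0)} (σ, β) = β α₀`, and on a small ball about `(0,0)`:
`E` maps into `T`, `ψ ∘ E` is smooth, vanishes on `{β = 0}`, and
`‖ψ (E (σ, β)) - β α₀‖ ≤ (‖α₀‖/2) ‖β‖` (mean value inequality). [folklore] -/
theorem leafFunction_sheetChart [FiniteDimensional ℝ F] (h4 : Module.finrank ℝ F = 4)
    {J : F → F →L[ℝ] F} (hJ : ContDiff ℝ ∞ J) {b : ℂ → F} (hb : ContDiff ℝ ∞ b)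
    (hinj : Injective (fderiv ℝ b 0)) {ν₀ : F} (hinjE : Injective (sheetChartDeriv J b ν₀ 0))
    {ψ : F → ℂ} {T : Set F} (hT : IsOpen T) (hbT : b 0 ∈ T) (hψ : ContDiffOn ℝ ∞ ψ T)
    (hψb : ∀ᶠ z in 𝓝 (0 : ℂ), ψ (b z) = 0)
    (hψJ : ∀ V : F, fderiv ℝ ψ (b 0) (J (b 0) V) = Complex.I * fderiv ℝ ψ (b 0) V)
    (hψsurj : Surjective (fderiv ℝ ψ (b 0))) :
    fderiv ℝ ψ (b 0) ν₀ ≠ 0 ∧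
    (∀ q : ℂ × ℂ, fderiv ℝ (fun p => ψ (sheetChart J b ν₀ p)) (0, 0) q =
      q.2 * fderiv ℝ ψ (b 0) ν₀) ∧
    ∃ δ₁ : ℝ, 0 < δ₁ ∧ (∀ p ∈ ball ((0, 0) : ℂ × ℂ) δ₁, sheetChart J b ν₀ p ∈ T) ∧
      ContDiffOn ℝ ∞ (fun p => ψ (sheetChart J b ν₀ p)) (ball ((0, 0) : ℂ × ℂ) δ₁) ∧
      (∀ p ∈ ball ((0, 0) : ℂ × ℂ) δ₁, p.2 = 0 → ψ (sheetChart J b ν₀ p) = 0) ∧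
      (∀ p ∈ ball ((0, 0) : ℂ × ℂ) δ₁,
        ‖ψ (sheetChart J b ν₀ p) - p.2 * fderiv ℝ ψ (b 0) ν₀‖ ≤
          ‖fderiv ℝ ψ (b 0) ν₀‖ / 2 * ‖p.2‖) := by
  set E := sheetChart J b ν₀ with hE_def
  set Dψ : F →L[ℝ] ℂ := fderiv ℝ ψ (b 0) with hDψ_def
  set α₀ : ℂ := Dψ ν₀ with hα₀_def
  set A : ℂ × ℂ → ℂ := fun p => ψ (E p) with hA_def
  have hE : ContDiff ℝ ∞ E := contDiff_sheetChart hJ hb ν₀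
  have hE0 : E (0, 0) = b 0 := sheetChart_mk_zero J b ν₀ 0
  -- the open set `U = E ⁻¹' T ∋ (0,0)` on which `A` is smooth
  have hU : IsOpen (E ⁻¹' T) := hT.preimage hE.continuous
  have h0U : ((0, 0) : ℂ × ℂ) ∈ E ⁻¹' T := by
    show E (0, 0) ∈ T
    rw [hE0]
    exact hbT
  have hA : ContDiffOn ℝ ∞ A (E ⁻¹' T) := hψ.comp hE.contDiffOn fun p hp => hp
  -- the derivative of `A` at `(0,0)`
  have hψd : DifferentiableAt ℝ ψ (b 0) :=
    (hψ.differentiableOn (by simp)).differentiableAt (hT.mem_nhds hbT)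
  have hdE : HasFDerivAt E (sheetChartDeriv J b ν₀ 0) (0, 0) :=
    hasFDerivAt_sheetChart ((hb.differentiable (by simp)) 0)
      (((hJ.clm_apply contDiff_const).differentiable (by simp)) _)
  have hDA : HasFDerivAt A (Dψ.comp (sheetChartDeriv J b ν₀ 0)) (0, 0) := by
    have hg : HasFDerivAt ψ Dψ (E (0, 0)) := by
      rw [hE0]
      exact hψd.hasFDerivAt
    exact hg.comp (0, 0) hdE
  -- `A (σ, 0) = ψ (b σ) = 0` near `σ = 0`
  have hA0 : ∀ᶠ σ in 𝓝 (0 : ℂ), A (σ, 0) = 0 := by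
    filter_upwards [hψb] with σ hσ
    show ψ (E (σ, 0)) = 0
    rw [show E (σ, 0) = b σ from sheetChart_mk_zero J b ν₀ σ]
    exact hσ
  -- hence `DA (σ, 0) = 0`
  have hDA1 : ∀ σ : ℂ, Dψ (sheetChartDeriv J b ν₀ 0 (σ, 0)) = 0 := by
    intro σ
    have hι : HasFDerivAt (fun σ : ℂ => ((σ, (0 : ℂ)) : ℂ × ℂ))
        ((ContinuousLinearMap.id ℝ ℂ).prod (0 : ℂ →L[ℝ] ℂ)) 0 :=
      (hasFDerivAt_id (0 : ℂ)).prodMk (hasFDerivAt_const (0 : ℂ) (0 : ℂ))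
    have h1 : HasFDerivAt (fun σ : ℂ => A (σ, 0))
        ((Dψ.comp (sheetChartDeriv J b ν₀ 0)).comp
          ((ContinuousLinearMap.id ℝ ℂ).prod (0 : ℂ →L[ℝ] ℂ))) 0 :=
      HasFDerivAt.comp (0 : ℂ) (f := fun σ : ℂ => ((σ, (0 : ℂ)) : ℂ × ℂ)) hDA hι
    have h2 : HasFDerivAt (fun σ : ℂ => A (σ, 0)) (0 : ℂ →L[ℝ] ℂ) 0 :=
      (hasFDerivAt_const (0 : ℂ) (0 : ℂ)).congr_of_eventuallyEq hA0
    have h3 := DFunLike.congr_fun (h1.unique h2) σ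
    simpa using h3
  -- and `DA (0, β) = β α₀`
  have hDA2 : ∀ β : ℂ, Dψ (sheetChartDeriv J b ν₀ 0 (0, β)) = β * α₀ := by
    intro β
    rw [sheetChartDeriv_apply]
    simp only [map_zero, zero_add, map_add, map_smul]
    rw [hψJ ν₀, Complex.real_smul, Complex.real_smul]
    conv_rhs => rw [← Complex.re_add_im β]
    ring
  have hDAq : ∀ q : ℂ × ℂ, (Dψ.comp (sheetChartDeriv J b ν₀ 0)) q = q.2 * α₀ := by
    intro q
    have hq : q = (q.1, 0) + (0, q.2) := by ext <;> simp
    conv_lhs => rw [hq]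
    rw [map_add, ContinuousLinearMap.comp_apply, ContinuousLinearMap.comp_apply, hDA1, hDA2,
      zero_add]
  -- `α₀ ≠ 0`: otherwise `ν₀ ∈ ker Dψ = range Db(0)`, contradicting injectivity of `dE`
  have hα : α₀ ≠ 0 := by
    intro hα0
    -- `Dψ ∘ Db(0) = 0`
    have hcomp0 : ∀ α : ℂ, Dψ (fderiv ℝ b 0 α) = 0 := by
      intro α
      have h1 : HasFDerivAt (fun z => ψ (b z)) (Dψ.comp (fderiv ℝ b 0)) 0 :=
        hψd.hasFDerivAt.comp (0 : ℂ) ((hb.differentiable (by simp)) 0).hasFDerivAt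
      have h2 : HasFDerivAt (fun z => ψ (b z)) (0 : ℂ →L[ℝ] ℂ) 0 :=
        (hasFDerivAt_const (0 : ℂ) (0 : ℂ)).congr_of_eventuallyEq hψb
      have h3 := DFunLike.congr_fun (h1.unique h2) α
      simpa using h3
    -- dimension count: `range Db(0) = ker Dψ`
    have hle : LinearMap.range ((fderiv ℝ b 0 : ℂ →L[ℝ] F) : ℂ →ₗ[ℝ] F) ≤
        LinearMap.ker (Dψ : F →ₗ[ℝ] ℂ) := by
      rintro _ ⟨α, rfl⟩
      exact hcomp0 α
    have hKdim : Module.finrank ℝ (LinearMap.ker (Dψ : F →ₗ[ℝ] ℂ)) = 2 := by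
      have h1 := LinearMap.finrank_range_add_finrank_ker (Dψ : F →ₗ[ℝ] ℂ)
      have hr : LinearMap.range (Dψ : F →ₗ[ℝ] ℂ) = ⊤ := LinearMap.range_eq_top.2 hψsurj
      have h2 : Module.finrank ℝ (LinearMap.range (Dψ : F →ₗ[ℝ] ℂ)) = 2 := by
        rw [hr, finrank_top, Complex.finrank_real_complex]
      rw [h2, h4] at h1
      omega
    have hRgdim : Module.finrank ℝ (LinearMap.range ((fderiv ℝ b 0 : ℂ →L[ℝ] F) : ℂ →ₗ[ℝ] F))
        = 2 := by
      have hinj' : Injective ((fderiv ℝ b 0 : ℂ →L[ℝ] F) : ℂ →ₗ[ℝ] F) := hinj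
      rw [LinearMap.finrank_range_of_inj hinj', Complex.finrank_real_complex]
    have heq := Submodule.eq_of_le_of_finrank_eq hle (by rw [hKdim, hRgdim])
    have hν : ν₀ ∈ LinearMap.ker (Dψ : F →ₗ[ℝ] ℂ) := hα0
    rw [← heq] at hν
    obtain ⟨α, hαν⟩ := hν
    have h1 : sheetChartDeriv J b ν₀ 0 (α, 0) = sheetChartDeriv J b ν₀ 0 (0, 1) := by
      rw [sheetChartDeriv_apply, sheetChartDeriv_apply]
      simp only [Complex.zero_re, zero_smul, add_zero, Complex.zero_im, map_zero, Complex.one_re,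
        one_smul, zero_add, Complex.one_im]
      exact hαν
    have h2 := hinjE h1
    simp at h2
  -- the linear model `L₀ (σ, β) = β α₀` and `G = A - L₀`
  set L₀ : ℂ × ℂ →L[ℝ] ℂ := (ContinuousLinearMap.snd ℝ ℂ ℂ).smulRight α₀ with hL₀_def
  have hL₀ : ∀ q : ℂ × ℂ, L₀ q = q.2 * α₀ := fun q => by
    simp [hL₀_def, smul_eq_mul]
  set G : ℂ × ℂ → ℂ := fun p => A p - L₀ p with hG_def
  have hG : ContDiffOn ℝ ∞ G (E ⁻¹' T) := hA.sub L₀.contDiff.contDiffOn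
  have hGc : ContinuousOn (fderiv ℝ G) (E ⁻¹' T) := hG.continuousOn_fderiv_of_isOpen hU (by simp)
  have hfA : fderiv ℝ A (0, 0) = Dψ.comp (sheetChartDeriv J b ν₀ 0) := hDA.fderiv
  have hGd : HasFDerivAt G (Dψ.comp (sheetChartDeriv J b ν₀ 0) - L₀) (0, 0) :=
    hDA.sub L₀.hasFDerivAt
  have hG0 : fderiv ℝ G (0, 0) = 0 := by
    rw [hGd.fderiv]
    refine ContinuousLinearMap.ext fun q => ?_
    simp only [FunLike.coe_sub, Pi.sub_apply, hDAq q, hL₀ q, sub_self, FunLike.coe_zero,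
      Pi.zero_apply]
  -- smallness of `fderiv G` near `(0,0)`, inside `E ⁻¹' T`
  have hsmall : ∀ᶠ p in 𝓝 ((0, 0) : ℂ × ℂ), ‖fderiv ℝ G p‖ < ‖α₀‖ / 2 ∧ p ∈ E ⁻¹' T := by
    have hca : ContinuousAt (fderiv ℝ G) (0, 0) := hGc.continuousAt (hU.mem_nhds h0U)
    have hcn := hca.norm
    have hlt : ‖fderiv ℝ G (0, 0)‖ < ‖α₀‖ / 2 := by
      rw [hG0, norm_zero]
      exact half_pos (norm_pos_iff.2 hα)
    exact (hcn.eventually_lt continuousAt_const hlt).and (hU.mem_nhds h0U)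
  obtain ⟨δ₀, hδ₀, hδ₀b⟩ := Metric.eventually_nhds_iff_ball.1 hA0
  obtain ⟨δ₂, hδ₂, hδ₂b⟩ := Metric.eventually_nhds_iff_ball.1 hsmall
  set δ₁ : ℝ := min δ₀ δ₂ with hδ₁_def
  have hδ₁ : 0 < δ₁ := lt_min hδ₀ hδ₂
  have hδ₁₀ : δ₁ ≤ δ₀ := min_le_left _ _
  have hδ₁₂ : δ₁ ≤ δ₂ := min_le_right _ _
  -- points of the small ball: the foot `(p.1, 0)` and the vanishing of `A` there
  have hfoot : ∀ p ∈ ball ((0, 0) : ℂ × ℂ) δ₁,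
      ((p.1, 0) : ℂ × ℂ) ∈ ball ((0, 0) : ℂ × ℂ) δ₁ ∧ A (p.1, 0) = 0 := by
    intro p hp
    rw [mem_ball, Prod.dist_eq] at hp
    have h1 : dist p.1 0 < δ₁ := lt_of_le_of_lt (le_max_left _ _) hp
    refine ⟨?_, hδ₀b p.1 (by rw [mem_ball]; exact h1.trans_le hδ₁₀)⟩
    rw [mem_ball, Prod.dist_eq]
    simpa using h1
  refine ⟨hα, fun q => by rw [hfA]; exact hDAq q, δ₁, hδ₁, fun p hp =>
    (hδ₂b p (ball_subset_ball hδ₁₂ hp)).2, hA.mono fun p hp => (hδ₂b p (ball_subset_ball hδ₁₂ hp)).2,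
    fun p hp hp2 => ?_, fun p hp => ?_⟩
  · -- vanishing on the axis
    have h := (hfoot p hp).2
    have hp' : p = (p.1, 0) := Prod.ext rfl hp2
    rw [hp']
    exact h
  · -- the mean value inequality on the convex ball `B((0,0), δ₂)`
    have hdiff : ∀ x ∈ ball ((0, 0) : ℂ × ℂ) δ₂, DifferentiableAt ℝ G x := fun x hx =>
      (hG.differentiableOn (by simp)).differentiableAt (hU.mem_nhds (hδ₂b x hx).2)
    have key := (convex_ball ((0, 0) : ℂ × ℂ) δ₂).norm_image_sub_le_of_norm_fderiv_le hdiff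
      (fun x hx => (hδ₂b x hx).1.le) (ball_subset_ball hδ₁₂ (hfoot p hp).1)
      (ball_subset_ball hδ₁₂ hp)
    have hG1 : G (p.1, 0) = 0 := by
      show A (p.1, 0) - L₀ (p.1, 0) = 0
      rw [(hfoot p hp).2, hL₀, zero_mul, sub_zero]
    have hn : ‖p - (p.1, 0)‖ = ‖p.2‖ := by
      obtain ⟨z, w⟩ := p
      simp
    rw [hG1, sub_zero, hn] at key
    have hGp : G p = A p - p.2 * α₀ := by
      show A p - L₀ p = A p - p.2 * α₀
      rw [hL₀]
    rw [hGp] at key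
    exact key

end LeafCoordinate

end Literature.Geometry.Symplectic

end
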